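import Literature.NumberTheory.Transcendental.BakerModels
import Literature.NumberTheory.Transcendental.BakerFieldG
import Literature.NumberTheory.Transcendental.SiegelEntries
import Literature.NumberTheory.Transcendental.SiegelSystem
import Literature.NumberTheory.Transcendental.AuxiliaryFunctionSharp
import Literature.NumberTheory.Transcendental.LiouvilleStep
import HarnessLib

/-!
# The `K`-models of the line derivations and chart polynomials at a general algebraic point

Topic: `Literature/NumberTheory/Transcendental`. Unit
`provefact-Literature.NumberTheory.Transcendental.s-efcbe22610` (fact `semistabilityTheorem_std`).
This is `BakerModels.lean` VERBATIM for the general-point data `BakerDataG` of `BakerFieldG.lean`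
in place of the torsion-point data `BakerData` of `BakerField.lean`: the `K`-models
`BakerDataG.QK`, `BakerDataG.HK` of the line derivation data and chart polynomials, their base
change (`map_QK`, `map_HK`), degree (`totalDegree_QK_le`, through the generic
`BakerData.totalDegree_genODEᵣ_le`) and denominators for `d₁ = 2·den` (`isDenInt_QK`,
`isDenInt_HK`). Nothing here depends on the point beyond the field `K`; the generic helper
lemmas of `BakerModels.lean` (`ArithPoly.totalDegree_ofNat`, …) are imported, not restated.
Everything is proved; no named facts.

## References

* A. Baker, G. Wüstholz, *Logarithmic Forms and Diophantine Geometry*, CUP 2007, §6.8.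
-/

noncomputable section

open Complex MvPolynomial
open Literature.NumberTheory.Transcendental.ArithPoly
open scoped PeriodPair

namespace Literature.NumberTheory.Transcendental



namespace GaGmE

namespace Std

namespace BakerDataG

variable {β γ δ : Type} [Fintype β] [Fintype γ] [Fintype δ] [DecidableEq γ]
variable (B : BakerDataG β γ δ)

/-- Integrality over `ℤ` in `K`, with the `ℤ`-algebra structure pinned to `Ring.toIntAlgebra` (the
one used by `ArithPoly.IsDenInt` and `AlgebraicGeneratorsField`; the intermediate field also
carries the propositionally equal `IntermediateField.algebra'`). [folklore] -/
abbrev IntZ (x : B.K) : Prop := @IsIntegral ℤ B.K _ _ (Ring.toIntAlgebra _) x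

/-! ### The `K`-valued coefficients and models -/

/-- the coordinates of the directions in `K`. [folklore] -/
abbrev xK (m : Fin B.dd) (k : β ⊕ (γ ⊕ δ)) : B.K := B.gK' (BIdx.dir m k)

/-- **The `K`-model of the line derivation data** for the chart choice `c` and direction `x_m`.
[folklore] -/
def QK (c : γ → Bool) (m : Fin B.dd) : Gen β γ δ → MvPolynomial (Gen β γ δ) B.K :=
  genODEᵣ B.g2K B.g3K B.κK c (B.xK m)

/-- **The `K`-model of the chart polynomials** for the chart choice `c`. [folklore] -/
def HK (c : γ → Bool) : Option β × ThetaIdx γ δ → MvPolynomial (Gen β γ δ) B.K :=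
  HPolyᵣ B.g2K B.g3K B.κK c

/-- `QK` maps to `genODE`. [folklore] -/
theorem map_QK (c : γ → Bool) (m : Fin B.dd) (i : Gen β γ δ) :
    map B.emb (B.QK c m i) = genODE B.L B.κM c (B.xs m) i := by
  rw [QK, map_genODEᵣ]
  exact congrFun (genODEᵣ_complex B.L B.κM c (B.xs m)) i

/-- `HK` maps to `HPoly`. [folklore] -/
theorem map_HK (c : γ → Bool) (J : Option β × ThetaIdx γ δ) :
    map B.emb (B.HK c J) = HPoly B.L B.κM c J := by
  rw [HK, map_HPolyᵣ]
  exact congrFun (HPolyᵣ_complex (β := β) B.L B.κM c) J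

/-! ### Degrees -/



/-- `deg QK ≤ 2`. [folklore] -/
theorem totalDegree_QK_le (c : γ → Bool) (m : Fin B.dd) (i : Gen β γ δ) : (B.QK c m i).totalDegree ≤ 2 :=
  BakerData.totalDegree_genODEᵣ_le _ _ _ _ _ _

/-! ### Denominators -/

/-- The working denominator `d₁ = 2·den` (the explicit formulas involve halves). [folklore] -/
abbrev d₁ : ℤ := 2 * B.den

/-- `d₁ · (datum) ∈ 𝓞_K`. [folklore] -/
theorem isIntegral_d₁_mul_gK' (t : B.BIdx) : B.IntZ ((B.d₁ : B.K) * B.gK' t) := by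
  have h := B.gens.isIntegral_den_mul_genK t
  have e : ((B.d₁ : ℤ) : B.K) * B.gK' t = (2 : B.K) * ((B.den : B.K) * B.gK' t) := by
    simp only [d₁, Int.cast_mul, Int.cast_ofNat]; ring
  show IsIntegral ℤ _
  rw [e]
  exact (isIntegral_intCast (B := B.K) 2).mul h

/-- `d₁ · (datum / 2) ∈ 𝓞_K`. [folklore] -/
theorem isIntegral_d₁_mul_half_gK' (t : B.BIdx) : B.IntZ ((B.d₁ : B.K) * (B.gK' t / 2)) := by
  have h := B.gens.isIntegral_den_mul_genK t
  have e : ((B.d₁ : ℤ) : B.K) * (B.gK' t / 2) = (B.den : B.K) * B.gK' t := by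
    simp only [d₁, Int.cast_mul, Int.cast_ofNat]; field_simp
  show IsIntegral ℤ _
  rwa [e]

/-- `d₁ · (n · datum / 2) ∈ 𝓞_K` for an integer `n`. [folklore] -/
theorem isIntegral_d₁_mul_int_mul_half_gK' (n : ℤ) (t : B.BIdx) :
    B.IntZ ((B.d₁ : B.K) * (n * B.gK' t / 2)) := by
  have h := B.isIntegral_d₁_mul_half_gK' t
  have e : ((B.d₁ : ℤ) : B.K) * (n * B.gK' t / 2) = (n : B.K) * ((B.d₁ : B.K) * (B.gK' t / 2)) := by ring
  show IsIntegral ℤ _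
  rw [e]
  exact (isIntegral_intCast (B := B.K) n).mul h

/-- `d₁ · (n · datum) ∈ 𝓞_K` for an integer `n`. [folklore] -/
theorem isIntegral_d₁_mul_int_mul_gK' (n : ℤ) (t : B.BIdx) :
    B.IntZ ((B.d₁ : B.K) * (n * B.gK' t)) := by
  have e : ((B.d₁ : ℤ) : B.K) * (n * B.gK' t) = (n : B.K) * ((B.d₁ : B.K) * B.gK' t) := by ring
  show IsIntegral ℤ _
  rw [e]
  exact (isIntegral_intCast (B := B.K) n).mul (B.isIntegral_d₁_mul_gK' t)

/-- `d₁ · (-1/2) ∈ 𝓞_K`. [folklore] -/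
theorem isIntegral_d₁_mul_neg_half : B.IntZ ((B.d₁ : B.K) * (-1 / 2)) := by
  have e : ((B.d₁ : ℤ) : B.K) * (-1 / 2) = ((-B.den : ℤ) : B.K) := by
    simp only [d₁, Int.cast_mul, Int.cast_ofNat, Int.cast_neg]; field_simp
  show IsIntegral ℤ _
  rw [e]; exact isIntegral_intCast (B := B.K) _

/-- `d₁ · (1/2) ∈ 𝓞_K`. [folklore] -/
theorem isIntegral_d₁_mul_half : B.IntZ ((B.d₁ : B.K) * (1 / 2)) := by
  have e : ((B.d₁ : ℤ) : B.K) * (1 / 2) = ((B.den : ℤ) : B.K) := by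
    simp only [d₁, Int.cast_mul, Int.cast_ofNat]; field_simp
  show IsIntegral ℤ _
  rw [e]; exact isIntegral_intCast (B := B.K) _

section DenHelpers

variable {e : ℕ}

/-- A constant with denominator `d₁`. [folklore] -/
theorem isDenInt_C_of {a : B.K} (h : B.IntZ ((B.d₁ : B.K) * a)) :
    IsDenInt B.d₁ 1 (C a : MvPolynomial (Gen β γ δ) B.K) :=
  IsDenInt.C (by simpa using h)

/-- Variables. [folklore] -/
theorem isDenInt_X (k : Gen β γ δ) (e : ℕ) : IsDenInt B.d₁ e (X k : MvPolynomial (Gen β γ δ) B.K) :=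
  (IsDenInt.X k).mono (Nat.zero_le e)

/-- Squares of variables. [folklore] -/
theorem isDenInt_X_sq (k : Gen β γ δ) (e : ℕ) : IsDenInt B.d₁ e ((X k : MvPolynomial (Gen β γ δ) B.K) ^ 2) := by
  have := (IsDenInt.X (d := B.d₁) (K := B.K) k).pow 2
  exact this.mono (Nat.zero_le e)

end DenHelpers

/-- **`d₁ · factorODEᵣ` has integral coefficients.** [folklore] -/
theorem isDenInt_factorODEᵣ (lat : Bool) (b : γ) (i : Fin 2) :
    IsDenInt B.d₁ 1 (factorODEᵣ (β := β) (δ := δ) B.g2K B.g3K lat b i) := by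
  have hg2h : IsDenInt B.d₁ 1 (C (B.g2K / 2) : MvPolynomial (Gen β γ δ) B.K) :=
    B.isDenInt_C_of (B.isIntegral_d₁_mul_half_gK' _)
  have hg2 : IsDenInt B.d₁ 1 (C B.g2K : MvPolynomial (Gen β γ δ) B.K) :=
    B.isDenInt_C_of (B.isIntegral_d₁_mul_gK' _)
  have hg3h : IsDenInt B.d₁ 1 (C (3 * B.g3K / 2) : MvPolynomial (Gen β γ δ) B.K) :=
    B.isDenInt_C_of (by simpa using B.isIntegral_d₁_mul_int_mul_half_gK' 3 BIdx.g3)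
  have hhalf : IsDenInt B.d₁ 1 (C (-1 / 2) : MvPolynomial (Gen β γ δ) B.K) :=
    B.isDenInt_C_of B.isIntegral_d₁_mul_neg_half
  have h6 : IsDenInt B.d₁ 1 (6 : MvPolynomial (Gen β γ δ) B.K) := (IsDenInt.ofNat _ 6).mono (Nat.zero_le 1)
  cases lat <;> fin_cases i <;>
    simp only [factorODEᵣ, Bool.false_eq_true, if_false, if_true, Fin.zero_eta, Fin.mk_one, Fin.isValue,
      Matrix.cons_val_zero, Matrix.cons_val_one, Matrix.cons_val_fin_one]
  · exact B.isDenInt_X _ 1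
  · exact (h6.mul (B.isDenInt_X_sq _ 0)).sub hg2h
  · rw [neg_mul]
    exact (h6.mul (B.isDenInt_X_sq _ 0)).neg.add (hg2h.mul (B.isDenInt_X_sq _ 0))
  · exact (hhalf.sub ((hg2.mul (B.isDenInt_X _ 0)).mul (B.isDenInt_X _ 0))).sub
      (hg3h.mul (B.isDenInt_X_sq _ 0))

/-- **`d₁ · zetaHatODEᵣ` has integral coefficients.** [folklore] -/
theorem isDenInt_zetaHatODEᵣ (lat : Bool) (b : γ) :
    IsDenInt B.d₁ 1 (zetaHatODEᵣ (β := β) (δ := δ) B.g2K B.g3K lat b) := by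
  have h2g2 : IsDenInt B.d₁ 1 (C (2 * B.g2K) : MvPolynomial (Gen β γ δ) B.K) :=
    B.isDenInt_C_of (by simpa using B.isIntegral_d₁_mul_int_mul_gK' 2 BIdx.g2)
  have h3g3 : IsDenInt B.d₁ 1 (C (3 * B.g3K) : MvPolynomial (Gen β γ δ) B.K) :=
    B.isDenInt_C_of (by simpa using B.isIntegral_d₁_mul_int_mul_gK' 3 BIdx.g3)
  cases lat <;> simp only [zetaHatODEᵣ, Bool.false_eq_true, if_false, if_true]
  · exact (B.isDenInt_X _ 1).neg
  · rw [neg_mul]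
    exact (h2g2.mul (B.isDenInt_X_sq _ 0)).neg.sub ((h3g3.mul (B.isDenInt_X _ 0)).mul (B.isDenInt_X _ 0))

/-- **`d₁³ · QK` has integral coefficients.** [folklore] -/
theorem isDenInt_QK (c : γ → Bool) (m : Fin B.dd) (i : Gen β γ δ) : IsDenInt B.d₁ 3 (B.QK c m i) := by
  have hx : ∀ k, IsDenInt B.d₁ 1 (C (B.xK m k) : MvPolynomial (Gen β γ δ) B.K) := fun k =>
    B.isDenInt_C_of (B.isIntegral_d₁_mul_gK' _)
  have hκx : ∀ e b, IsDenInt B.d₁ 2 (C (B.κK e b * B.xK m (iz b)) : MvPolynomial (Gen β γ δ) B.K) := by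
    intro e b
    rw [C_mul]
    exact (B.isDenInt_C_of (B.isIntegral_d₁_mul_gK' _)).mul (hx _)
  rcases i with j | ⟨b, i⟩ | e
  · exact ((hx _).mul (B.isDenInt_X _ 0)).mono (by norm_num)
  · exact ((hx _).mul (B.isDenInt_factorODEᵣ _ _ _)).mono (by norm_num)
  · show IsDenInt B.d₁ 3 (C (B.xK m (is e)) - ∑ b, C (B.κK e b * B.xK m (iz b)) * zetaHatODEᵣ B.g2K B.g3K (c b) b)
    exact ((hx _).mono (by norm_num)).sub (IsDenInt.sum fun b _ => (hκx e b).mul (B.isDenInt_zetaHatODEᵣ _ _))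

/-- `rPolyᵣ` carries no denominator. [folklore] -/
theorem isDenInt_rPolyᵣ (lat : Bool) (b : γ) (i : Fin 3) :
    IsDenInt B.d₁ 0 (rPolyᵣ (β := β) (δ := δ) (R := B.K) lat b i) := by
  cases lat <;> fin_cases i <;>
    simp only [rPolyᵣ, Bool.false_eq_true, if_false, if_true, Fin.zero_eta, Fin.mk_one, Fin.isValue,
      Fin.reduceFinMk, Matrix.cons_val_zero, Matrix.cons_val_one, Matrix.cons_val] <;>
    first | exact IsDenInt.one _ | exact IsDenInt.X _

/-- **`d₁ · corrPolyᵣ` has integral coefficients.** [folklore] -/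
theorem isDenInt_corrPolyᵣ (lat : Bool) (b : γ) (i : Fin 3) :
    IsDenInt B.d₁ 1 (corrPolyᵣ (β := β) (δ := δ) B.g2K B.g3K lat b i) := by
  have hg2h : IsDenInt B.d₁ 1 (C (B.g2K / 2) : MvPolynomial (Gen β γ δ) B.K) :=
    B.isDenInt_C_of (B.isIntegral_d₁_mul_half_gK' _)
  have hg3h : IsDenInt B.d₁ 1 (C (B.g3K / 2) : MvPolynomial (Gen β γ δ) B.K) :=
    B.isDenInt_C_of (B.isIntegral_d₁_mul_half_gK' _)
  have hhalf : IsDenInt B.d₁ 1 (C (1 / 2) : MvPolynomial (Gen β γ δ) B.K) :=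
    B.isDenInt_C_of B.isIntegral_d₁_mul_half
  have h2 : IsDenInt B.d₁ 1 (2 : MvPolynomial (Gen β γ δ) B.K) := (IsDenInt.ofNat _ 2).mono (Nat.zero_le 1)
  cases lat <;> fin_cases i <;>
    simp only [corrPolyᵣ, Bool.false_eq_true, if_false, if_true, Fin.zero_eta, Fin.mk_one, Fin.isValue,
      Fin.reduceFinMk, Matrix.cons_val_zero, Matrix.cons_val_one, Matrix.cons_val]
  · exact IsDenInt.zero
  · exact IsDenInt.zero
  · exact h2.mul (B.isDenInt_X_sq _ 0)
  · rw [neg_mul]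
    exact (h2.mul (B.isDenInt_X_sq _ 0)).neg
  · exact (hhalf.neg.sub ((hg2h.mul (B.isDenInt_X _ 0)).mul (B.isDenInt_X _ 0))).sub
      (hg3h.mul (B.isDenInt_X_sq _ 0))
  · exact IsDenInt.zero

/-- `TPolyᵣ` carries no denominator. [folklore] -/
theorem isDenInt_TPolyᵣ (a : Option β) : IsDenInt B.d₁ 0 (TPolyᵣ (γ := γ) (δ := δ) (R := B.K) a) := by
  cases a
  · exact IsDenInt.one _
  · exact IsDenInt.X _

/-- **`d₁² · HK` has integral coefficients.** [folklore] -/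
theorem isDenInt_HK (c : γ → Bool) (J : Option β × ThetaIdx γ δ) : IsDenInt B.d₁ 2 (B.HK c J) := by
  have hprod : ∀ (M : γ → Fin 3) (s : Finset γ),
      IsDenInt B.d₁ 0 (∏ b ∈ s, rPolyᵣ (β := β) (δ := δ) (R := B.K) (c b) b (M b)) := fun M s =>
    IsDenInt.prod_zero s fun b _ => B.isDenInt_rPolyᵣ _ _ _
  rcases J with ⟨a, M, _ | e⟩
  · show IsDenInt B.d₁ 2 (TPolyᵣ a * ∏ b, rPolyᵣ (c b) b (M b))
    exact ((B.isDenInt_TPolyᵣ a).mul (hprod M Finset.univ)).mono (by norm_num)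
  · show IsDenInt B.d₁ 2 (TPolyᵣ a * (X (Sum.inr (Sum.inr e)) * ∏ b, rPolyᵣ (c b) b (M b) -
        ∑ b, C (B.κK e b) * (corrPolyᵣ B.g2K B.g3K (c b) b (M b) *
          ∏ b' ∈ Finset.univ.erase b, rPolyᵣ (c b') b' (M b'))))
    refine ((B.isDenInt_TPolyᵣ a).mul (IsDenInt.sub (e := 2) ?_ ?_)).mono (by norm_num)
    · exact ((B.isDenInt_X _ 0).mul (hprod M Finset.univ)).mono (by norm_num)
    · exact IsDenInt.sum fun b _ =>
        (B.isDenInt_C_of (B.isIntegral_d₁_mul_gK' _)).mul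
          ((B.isDenInt_corrPolyᵣ _ _ _).mul (hprod M _))

end BakerDataG

end Std

end GaGmE

end Literature.NumberTheory.Transcendental

end

/-!
# The entries of the Siegel system at a general algebraic point: explicit arithmetic bounds

Topic: `Literature/NumberTheory/Transcendental`. Unit
`provefact-Literature.NumberTheory.Transcendental.s-efcbe22610` (fact `semistabilityTheorem_std`).
`SiegelEntries.lean` for the general-point data `BakerDataG` (`BakerFieldG.lean`,
`BakerModelsG.lean`): the uniform constants `qB`, `hB`, `hdeg`, the substituted monomials
`F_ν` with their bounds (verbatim), and the entries `entryVal s ω D ν = (W^{(s)}_ω F_ν)(gK s)`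
of the Siegel system with their bounds. The ONLY change is the shape of the arithmetic of the
point: the working denominator is `d_s = d₁ · pden s` (`pden s` the per-`s` denominator of the
generator values at `s·v`, bounded by their heights) instead of `d₁^{s+1}`, and the conjugate
bound is `gBound s = Mg^{(s+1)³}` (`BakerDataG.norm_embedding_gK_le`) instead of `(s+1)M^{s+1}`:
`entryVal_bounds` — `|σ(entryVal)| ≤ (D·hdeg + 2k)^k qB^k hB^D gBound(s)^{D·hdeg + 2k}` and
`d_s^{2D + 3k + D·hdeg + 2k} · entryVal ∈ 𝓞_K` (`ArithPoly.word_eval_bounds`). Everything is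
proved; no named facts.

## References

* A. Baker, G. Wüstholz, *Logarithmic Forms and Diophantine Geometry*, CUP 2007, §6.8.
-/

noncomputable section

open Complex MvPolynomial Finset
open Literature.NumberTheory.Transcendental.ArithPoly
open Literature.NumberTheory.Transcendental.Chudnovsky
open scoped PeriodPair

namespace Literature.NumberTheory.Transcendental



namespace GaGmE

namespace Std

namespace BakerDataG

variable {β γ δ : Type} [Fintype β] [Fintype γ] [Fintype δ] [DecidableEq γ]
variable (B : BakerDataG β γ δ)

/-! ### Uniform constants -/

/-- `‖·‖_σ 1 = 1` for the pullback seminorms. [folklore] -/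
theorem embSeminorm_one_le (σ : B.K →+* ℂ) : embSeminorm σ 1 ≤ 1 := by simp

/-- **A uniform bound for the sizes of the derivation data**:
`qB = ∑_{σ,c,m,i} ‖QK c m i‖_σ`. [folklore] -/
def qB : ℝ := ∑ σ : B.K →+* ℂ, ∑ c : γ → Bool, ∑ m : Fin B.dd, ∑ i : Gen β γ δ, wnorm (embSeminorm σ) (B.QK c m i)

/-- `qB ≥ 0`. [folklore] -/
theorem qB_nonneg : 0 ≤ B.qB :=
  Finset.sum_nonneg fun _ _ => Finset.sum_nonneg fun _ _ => Finset.sum_nonneg fun _ _ =>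
    Finset.sum_nonneg fun _ _ => wnorm_nonneg _ _

/-- `‖QK c m i‖_σ ≤ qB`. [folklore] -/
theorem wnorm_QK_le (σ : B.K →+* ℂ) (c : γ → Bool) (m : Fin B.dd) (i : Gen β γ δ) :
    wnorm (embSeminorm σ) (B.QK c m i) ≤ B.qB := by
  unfold qB
  refine le_trans ?_ (single_le_sum (f := fun σ' : B.K →+* ℂ => ∑ c : γ → Bool, ∑ m : Fin B.dd,
    ∑ i : Gen β γ δ, wnorm (embSeminorm σ') (B.QK c m i))
    (fun _ _ => Finset.sum_nonneg fun _ _ => Finset.sum_nonneg fun _ _ =>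
      Finset.sum_nonneg fun _ _ => wnorm_nonneg _ _) (mem_univ σ))
  refine le_trans ?_ (single_le_sum (f := fun c' : γ → Bool => ∑ m : Fin B.dd,
    ∑ i : Gen β γ δ, wnorm (embSeminorm σ) (B.QK c' m i))
    (fun _ _ => Finset.sum_nonneg fun _ _ => Finset.sum_nonneg fun _ _ => wnorm_nonneg _ _) (mem_univ c))
  refine le_trans ?_ (single_le_sum (f := fun m' : Fin B.dd =>
    ∑ i : Gen β γ δ, wnorm (embSeminorm σ) (B.QK c m' i))
    (fun _ _ => Finset.sum_nonneg fun _ _ => wnorm_nonneg _ _) (mem_univ m))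
  exact single_le_sum (f := fun i' => wnorm (embSeminorm σ) (B.QK c m i')) (fun _ _ => wnorm_nonneg _ _)
    (mem_univ i)

/-- **A uniform bound for the sizes of the chart polynomials**: `hB = 1 + ∑_{σ,c,J} ‖HK c J‖_σ`.
[folklore] -/
def hB : ℝ := 1 + ∑ σ : B.K →+* ℂ, ∑ c : γ → Bool, ∑ J : Option β × ThetaIdx γ δ, wnorm (embSeminorm σ) (B.HK c J)

/-- `1 ≤ hB`. [folklore] -/
theorem one_le_hB : 1 ≤ B.hB := by
  unfold hB
  have : 0 ≤ ∑ σ : B.K →+* ℂ, ∑ c : γ → Bool, ∑ J : Option β × ThetaIdx γ δ,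
      wnorm (embSeminorm σ) (B.HK c J) :=
    Finset.sum_nonneg fun _ _ => Finset.sum_nonneg fun _ _ => Finset.sum_nonneg fun _ _ => wnorm_nonneg _ _
  linarith

/-- `‖HK c J‖_σ ≤ hB`. [folklore] -/
theorem wnorm_HK_le (σ : B.K →+* ℂ) (c : γ → Bool) (J : Option β × ThetaIdx γ δ) :
    wnorm (embSeminorm σ) (B.HK c J) ≤ B.hB := by
  unfold hB
  have h1 : wnorm (embSeminorm σ) (B.HK c J) ≤ ∑ σ' : B.K →+* ℂ, ∑ c' : γ → Bool,
      ∑ J' : Option β × ThetaIdx γ δ, wnorm (embSeminorm σ') (B.HK c' J') := by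
    refine le_trans ?_ (single_le_sum (f := fun σ' : B.K →+* ℂ => ∑ c' : γ → Bool,
      ∑ J' : Option β × ThetaIdx γ δ, wnorm (embSeminorm σ') (B.HK c' J'))
      (fun _ _ => Finset.sum_nonneg fun _ _ => Finset.sum_nonneg fun _ _ => wnorm_nonneg _ _) (mem_univ σ))
    refine le_trans ?_ (single_le_sum (f := fun c' : γ → Bool =>
      ∑ J' : Option β × ThetaIdx γ δ, wnorm (embSeminorm σ) (B.HK c' J'))
      (fun _ _ => Finset.sum_nonneg fun _ _ => wnorm_nonneg _ _) (mem_univ c))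
    exact single_le_sum (f := fun J' => wnorm (embSeminorm σ) (B.HK c J')) (fun _ _ => wnorm_nonneg _ _)
      (mem_univ J)
  linarith

/-- **A uniform bound for the degrees of the chart polynomials.** [folklore] -/
def hdeg : ℕ := Finset.univ.sup fun cJ : (γ → Bool) × (Option β × ThetaIdx γ δ) => (B.HK cJ.1 cJ.2).totalDegree

/-- `deg HK c J ≤ hdeg`. [folklore] -/
theorem totalDegree_HK_le (c : γ → Bool) (J : Option β × ThetaIdx γ δ) : (B.HK c J).totalDegree ≤ B.hdeg :=
  Finset.le_sup (f := fun cJ : (γ → Bool) × (Option β × ThetaIdx γ δ) => (B.HK cJ.1 cJ.2).totalDegree)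
    (mem_univ (c, J))

/-! ### The substituted monomials `F_ν` -/

/-- `F_ν = homogMonomial D ν ∘ HK c` over `K`. [folklore] -/
def Fν (c : γ → Bool) (D : ℕ) (ν : β ⊕ (γ ⊕ δ) →₀ ℕ) : MvPolynomial (Gen β γ δ) B.K :=
  bind₁ (B.HK c) (homogMonomialᵣ D ν)

/-- The product formula for `F_ν` (with `μ = ν ∘ affIdx⁻¹`, `|μ| = |ν|`). [folklore] -/
theorem Fν_eq (c : γ → Bool) (D : ℕ) (ν : β ⊕ (γ ⊕ δ) →₀ ℕ) :
    B.Fν c D ν = B.HK c (baseIdx (genericChart (γ := γ))) ^ (D - ν.degree) *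
      ∏ i ∈ (ν.mapDomain affIdx).support, B.HK c i ^ (ν.mapDomain affIdx) i := by
  rw [Fν, homogMonomialᵣ, map_mul, map_pow, bind₁_X_right, bind₁_monomial, C_1, one_mul]

omit [Fintype β] [Fintype γ] [Fintype δ] in
/-- `|ν ∘ affIdx⁻¹| = |ν|`. [folklore] -/
theorem degree_mapDomain_affIdx (ν : β ⊕ (γ ⊕ δ) →₀ ℕ) :
    (ν.mapDomain (affIdx (β := β) (γ := γ) (δ := δ))).degree = ν.degree :=
  Finsupp.degree_mapDomain _ _

omit [Fintype β] [Fintype γ] [Fintype δ] [DecidableEq γ] in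
/-- The degree is the sum of the exponents over the support. [folklore] -/
theorem degree_eq_sum_support {α : Type*} (μ : α →₀ ℕ) : μ.degree = ∑ i ∈ μ.support, μ i := by
  rw [Finsupp.degree]; rfl

/-- **Bounds for `F_ν`**: for `|ν| ≤ D`, `deg F_ν ≤ D·hdeg`, `‖F_ν‖_σ ≤ hB^D`, `d₁^{2D} F_ν` integral.
[folklore] -/
theorem Fν_bounds (σ : B.K →+* ℂ) (c : γ → Bool) {D : ℕ} {ν : β ⊕ (γ ⊕ δ) →₀ ℕ} (hν : ν.degree ≤ D) :
    (B.Fν c D ν).totalDegree ≤ D * B.hdeg ∧ wnorm (embSeminorm σ) (B.Fν c D ν) ≤ B.hB ^ D ∧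
      IsDenInt B.d₁ (2 * D) (B.Fν c D ν) := by
  set μ := ν.mapDomain (affIdx (β := β) (γ := γ) (δ := δ)) with hμ
  have hμdeg : ∑ i ∈ μ.support, μ i = ν.degree := by
    rw [← degree_eq_sum_support, hμ, degree_mapDomain_affIdx]
  have hsplit : D - ν.degree + ν.degree = D := Nat.sub_add_cancel hν
  have h1 := B.embSeminorm_one_le σ
  have hB1 := B.one_le_hB
  rw [Fν_eq]
  refine ⟨?_, ?_, ?_⟩
  · -- degree
    refine (totalDegree_mul _ _).trans ?_
    have hA : (B.HK c (baseIdx genericChart) ^ (D - ν.degree)).totalDegree ≤ (D - ν.degree) * B.hdeg :=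
      (totalDegree_pow _ _).trans (Nat.mul_le_mul_left _ (B.totalDegree_HK_le _ _))
    have hP : (∏ i ∈ μ.support, B.HK c i ^ μ i).totalDegree ≤ ν.degree * B.hdeg := by
      refine (totalDegree_finsetProd _ _).trans ?_
      rw [← hμdeg, Finset.sum_mul]
      refine Finset.sum_le_sum fun i _ => ?_
      exact (totalDegree_pow _ _).trans (Nat.mul_le_mul_left _ (B.totalDegree_HK_le _ _))
    calc _ ≤ (D - ν.degree) * B.hdeg + ν.degree * B.hdeg := add_le_add hA hP
      _ = D * B.hdeg := by rw [← add_mul, hsplit]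
  · -- size
    refine (wnorm_mul_le _ _ _).trans ?_
    have hA : wnorm (embSeminorm σ) (B.HK c (baseIdx genericChart) ^ (D - ν.degree)) ≤ B.hB ^ (D - ν.degree) :=
      (wnorm_pow_le _ h1 _ _).trans (pow_le_pow_left₀ (wnorm_nonneg _ _) (B.wnorm_HK_le _ _ _) _)
    have hP : wnorm (embSeminorm σ) (∏ i ∈ μ.support, B.HK c i ^ μ i) ≤ B.hB ^ ν.degree := by
      refine (wnorm_prod_le _ h1 _ _).trans ?_
      rw [← hμdeg, ← Finset.prod_pow_eq_pow_sum]
      refine Finset.prod_le_prod (fun i _ => wnorm_nonneg _ _) fun i _ => ?_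
      exact (wnorm_pow_le _ h1 _ _).trans (pow_le_pow_left₀ (wnorm_nonneg _ _) (B.wnorm_HK_le _ _ _) _)
    calc _ ≤ B.hB ^ (D - ν.degree) * B.hB ^ ν.degree :=
          mul_le_mul hA hP (wnorm_nonneg _ _) (pow_nonneg (zero_le_one.trans hB1) _)
      _ = B.hB ^ D := by rw [← pow_add, hsplit]
  · -- denominators
    have hA : IsDenInt B.d₁ ((D - ν.degree) * 2) (B.HK c (baseIdx genericChart) ^ (D - ν.degree)) :=
      (B.isDenInt_HK c _).pow _
    have hP : IsDenInt B.d₁ (∑ i ∈ μ.support, μ i * 2) (∏ i ∈ μ.support, B.HK c i ^ μ i) :=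
      IsDenInt.prod' _ fun i _ => (B.isDenInt_HK c i).pow _
    have := hA.mul hP
    rw [← Finset.sum_mul, hμdeg, ← add_mul, hsplit, mul_comm] at this
    exact this

/-! ### The entries and their bounds -/

/-- The adapted chart at `s·v`. [folklore] -/
def cAt (s : ℕ) : γ → Bool := chartChoiceAt B.L ((s : ℂ) • B.v)

/-- The `K`-derivations of the adapted chart at `s·v` along the directions. [folklore] -/
def DK (s : ℕ) (m : Fin B.dd) : MvPolynomial (Gen β γ δ) B.K →ₗ[B.K] MvPolynomial (Gen β γ δ) B.K :=
  (mkDerivation B.K (B.QK (B.cAt s) m)).toLinearMap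

/-- **The entries of the Siegel system**: `entryVal s ω ν = (W^{(s)}_ω F_ν)(gK s)`.
[cite: BakerWustholz2007, §6.8] -/
def entryVal (s : ℕ) {k : ℕ} (ω : Fin k → Fin B.dd) (D : ℕ) (ν : β ⊕ (γ ⊕ δ) →₀ ℕ) : B.K :=
  MvPolynomial.eval (B.gK s) (PolyODE.wordApp (B.DK s) ω (B.Fν (B.cAt s) D ν))

/-- **The working denominator at `s·v`: `d_s = d₁ · pden s`** (`pden s` the per-`s` denominator of
the generator values, bounded by their heights, `BakerFieldG.lean`). [folklore] -/
def dAt (s : ℕ) : ℤ := B.d₁ * B.pden s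

/-- `d₁ ∣ d_s`. [folklore] -/
theorem d₁_dvd_dAt (s : ℕ) : B.d₁ ∣ B.dAt s := dvd_mul_right _ _

/-- `d_s · gK s i ∈ 𝓞_K`. [folklore] -/
theorem isIntegral_dAt_mul_gK (s : ℕ) (i : Gen β γ δ) : B.IntZ ((B.dAt s : B.K) * B.gK s i) := by
  have h := B.isIntegral_pden_mul_gK s i
  have e : ((B.dAt s : ℤ) : B.K) * B.gK s i = (B.d₁ : B.K) * ((B.pden s : B.K) * B.gK s i) := by
    simp only [dAt, Int.cast_mul, Int.cast_natCast]; ring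
  show IsIntegral ℤ _
  rw [e]
  exact (isIntegral_intCast (B := B.K) _).mul h

/-- `|d_s| ≤ |d₁| · gBound(s)^{#Gen}`. [folklore] -/
theorem abs_dAt_le (s : ℕ) : |(B.dAt s : ℝ)| ≤ |(B.d₁ : ℝ)| * B.gBound s ^ Fintype.card (Gen β γ δ) := by
  rw [dAt, Int.cast_mul, abs_mul, Int.cast_natCast, Nat.abs_cast]
  exact mul_le_mul_of_nonneg_left (B.pden_le s) (abs_nonneg _)

/-- `1 ≤ |d_s|`. [folklore] -/
theorem one_le_abs_dAt (s : ℕ) : (1 : ℝ) ≤ |(B.dAt s : ℝ)| := by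
  have h1 : (1 : ℝ) ≤ |(B.den : ℝ)| := B.gens.one_le_abs_den
  have h2 : (1 : ℝ) ≤ (B.pden s : ℝ) := by exact_mod_cast B.one_le_pden s
  rw [dAt, Int.cast_mul, abs_mul, Int.cast_natCast, Nat.abs_cast]
  have e : |((B.d₁ : ℤ) : ℝ)| = 2 * |(B.den : ℝ)| := by simp [d₁, abs_mul]
  rw [e]
  nlinarith

/-- **Bounds for the entries**: for a word `ω` of length `k` and `|ν| ≤ D`,
`|σ(entryVal)| ≤ (D·hdeg + 2k)^k qB^k hB^D gBound(s)^{D·hdeg + 2k}` for every embedding `σ`, and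
`d_s^{2D + 3k + (D·hdeg + 2k)} · entryVal ∈ 𝓞_K`. [cite: BakerWustholz2007, §6.8] -/
theorem entryVal_bounds (σ : B.K →+* ℂ) (s : ℕ) {k : ℕ} (ω : Fin k → Fin B.dd) {D : ℕ}
    {ν : β ⊕ (γ ⊕ δ) →₀ ℕ} (hν : ν.degree ≤ D) :
    ‖σ (B.entryVal s ω D ν)‖ ≤ (((D * B.hdeg : ℕ) : ℝ) + 2 * k) ^ k * B.qB ^ k * B.hB ^ D *
        B.gBound s ^ (D * B.hdeg + 2 * k) ∧
      B.IntZ ((B.dAt s : B.K) ^ (2 * D + k * 3 + (D * B.hdeg + 2 * k)) * B.entryVal s ω D ν) := by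
  obtain ⟨hdegF, hnormF, hdenF⟩ := B.Fν_bounds σ (B.cAt s) hν
  have hq : ∀ m i, wnorm (embSeminorm σ) (B.QK (B.cAt s) m i) ≤ B.qB := fun m i => B.wnorm_QK_le σ _ m i
  have hQdeg : ∀ m i, (B.QK (B.cAt s) m i).totalDegree ≤ 2 := fun m i => B.totalDegree_QK_le _ m i
  have hdQ : ∀ m i, IsDenInt (B.dAt s) 3 (B.QK (B.cAt s) m i) := fun m i =>
    (B.isDenInt_QK _ m i).of_dvd (B.d₁_dvd_dAt s)
  have hdF : IsDenInt (B.dAt s) (2 * D) (B.Fν (B.cAt s) D ν) := hdenF.of_dvd (B.d₁_dvd_dAt s)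
  have hM1 : 1 ≤ B.gBound s := B.one_le_gBound s
  have hg : ∀ i, ‖σ (B.gK s i)‖ ≤ B.gBound s := fun i => B.norm_embedding_gK_le σ s i
  have key := ArithPoly.word_eval_bounds σ B.qB_nonneg hq hQdeg hdQ hdegF hnormF hdF
    (fun i => B.isIntegral_dAt_mul_gK s i) hM1 hg ω
  exact key

end BakerDataG

end Std

end GaGmE

end Literature.NumberTheory.Transcendental

end

/-!
# The Siegel system at a general algebraic point: unknowns, equations, integrality, house bound

Topic: `Literature/NumberTheory/Transcendental`. Unit
`provefact-Literature.NumberTheory.Transcendental.s-efcbe22610` (fact `semistabilityTheorem_std`).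
`SiegelSystem.lean` for the general-point data `BakerDataG`: the unknowns (the generic
`BakerData.UIdx`, `BakerData.νOf` are reused, not restated), the equations `EIdx`, the matrix
`sMat` with entries `d_s^{E(D,k)} · rowSum ∈ 𝓞 K`, `rowSum_eq_zero_of_mulVec`, and the uniform
house bound `houseBound` with `house_sMat_le`. The only change w.r.t. the torsion-point file is
the arithmetic of the point: `|d_s| ≤ dB s = |d₁|·gBound(s)^{#Gen}` (monotone in `s`) replaces
`|d₁|^{s+1}` and `gBound s` replaces `(s+1)M^{s+1}`, so
`houseBound = dB(S₀)^{E_T}·(dd+1)^T·(nD'hdeg+2T+1)^T·max(1,qB)^T·hB^{nD'}·gBound(S₀)^{nD'hdeg+2T}`.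
Everything is proved; no named facts.

## References

* A. Baker, G. Wüstholz, *Logarithmic Forms and Diophantine Geometry*, CUP 2007, §6.8 (p. 118).
-/

noncomputable section

open Complex MvPolynomial Finset NumberField
open Literature.NumberTheory.Transcendental.ArithPoly
open Literature.NumberTheory.Transcendental.Chudnovsky
open scoped PeriodPair

namespace Literature.NumberTheory.Transcendental

namespace GaGmE

namespace Std

namespace BakerDataG

open BakerData (UIdx νOf νOf_apply νOf_injective degree_νOf_le)

variable {β γ δ : Type} [Fintype β] [Fintype γ] [Fintype δ] [DecidableEq γ]
variable (B : BakerDataG β γ δ)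

/-! ### Unknowns and equations -/

/-- The equations: `(s, k, α)` with `s ≤ S₀`, `k < T`, `α : Fin dd → Fin T` a content. [folklore] -/
abbrev EIdx (T S₀ : ℕ) : Type := Fin (S₀ + 1) × Fin T × (Fin B.dd → Fin T)

/-- The words of length `k` and content `α`. [folklore] -/
def wordsOf (k : ℕ) {T : ℕ} (α : Fin B.dd → Fin T) : Finset (Fin k → Fin B.dd) :=
  Finset.univ.filter fun ω => ∀ m, PolyODE.content ω m = (α m : ℕ)

/-- The row sums `∑_{ω of content α} entryVal s ω D ν`. [folklore] -/
def rowSum (D s k : ℕ) {T : ℕ} (α : Fin B.dd → Fin T) (ν : (β ⊕ (γ ⊕ δ)) →₀ ℕ) : B.K :=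
  ∑ ω ∈ B.wordsOf k α, B.entryVal s ω D ν

/-- The exponent of the denominator clearing row `(s, k)`. [folklore] -/
def expE (D k : ℕ) : ℕ := 2 * D + k * 3 + (D * B.hdeg + 2 * k)

/-- `d_s^E · rowSum ∈ 𝓞_K`. [folklore] -/
theorem isIntegral_rowSum (D s k : ℕ) {T : ℕ} (α : Fin B.dd → Fin T) {ν : (β ⊕ (γ ⊕ δ)) →₀ ℕ}
    (hν : ν.degree ≤ D) : B.IntZ ((B.dAt s : B.K) ^ B.expE D k * B.rowSum D s k α ν) := by
  show IsIntegral ℤ _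
  rw [rowSum, Finset.mul_sum]
  refine IsIntegral.sum _ fun ω _ => ?_
  exact (B.entryVal_bounds B.emb s ω hν).2

/-- `d_s ≠ 0` in `K`. [folklore] -/
theorem dAt_ne_zero (s : ℕ) : (B.dAt s : B.K) ≠ 0 := by
  have hden : (B.den : ℤ) ≠ 0 := B.gens.den_ne_zero
  have : (B.dAt s : ℤ) ≠ 0 := by
    simp only [dAt, d₁]
    exact mul_ne_zero (mul_ne_zero two_ne_zero hden) (by exact_mod_cast B.pden_ne_zero s)
  exact_mod_cast this

/-- **The matrix of the Siegel system** (entries in `𝓞 K`). [cite: BakerWustholz2007, §6.8 (p. 118)] -/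
def sMat (D' T S₀ : ℕ) : Matrix (B.EIdx T S₀) (UIdx β γ δ D') (𝓞 B.K) := fun r u =>
  ⟨(B.dAt r.1 : B.K) ^ B.expE (Fintype.card (β ⊕ (γ ⊕ δ)) * D') r.2.1 *
      B.rowSum (Fintype.card (β ⊕ (γ ⊕ δ)) * D') r.1 r.2.1 r.2.2 (νOf u),
    B.isIntegral_rowSum _ _ _ _ (degree_νOf_le u)⟩

/-- The value of an entry in `K`. [folklore] -/
@[simp] theorem coe_sMat (D' T S₀ : ℕ) (r : B.EIdx T S₀) (u : UIdx β γ δ D') :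
    ((B.sMat D' T S₀ r u : 𝓞 B.K) : B.K) =
      (B.dAt r.1 : B.K) ^ B.expE (Fintype.card (β ⊕ (γ ⊕ δ)) * D') r.2.1 *
        B.rowSum (Fintype.card (β ⊕ (γ ⊕ δ)) * D') r.1 r.2.1 r.2.2 (νOf u) := rfl

variable [DecidableEq β] [DecidableEq δ]

/-- **A solution of the Siegel system kills the row sums**: if `sMat ξ = 0` then for every row
`∑_u ξ_u · rowSum_u = 0` in `K`. [folklore] -/
theorem rowSum_eq_zero_of_mulVec {D' T S₀ : ℕ} {ξ : UIdx β γ δ D' → 𝓞 B.K}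
    (h : (B.sMat D' T S₀).mulVec ξ = 0) (r : B.EIdx T S₀) :
    ∑ u, (ξ u : B.K) * B.rowSum (Fintype.card (β ⊕ (γ ⊕ δ)) * D') r.1 r.2.1 r.2.2 (νOf u) = 0 := by
  have hr := congrFun h r
  simp only [Matrix.mulVec, dotProduct, Pi.zero_apply] at hr
  have hr' := congrArg (algebraMap (𝓞 B.K) B.K) hr
  rw [map_sum, map_zero] at hr'
  simp only [map_mul] at hr'
  have e : ∑ u, algebraMap (𝓞 B.K) B.K (B.sMat D' T S₀ r u) * algebraMap (𝓞 B.K) B.K (ξ u) =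
      (B.dAt r.1 : B.K) ^ B.expE (Fintype.card (β ⊕ (γ ⊕ δ)) * D') r.2.1 *
        ∑ u, (ξ u : B.K) * B.rowSum (Fintype.card (β ⊕ (γ ⊕ δ)) * D') r.1 r.2.1 r.2.2 (νOf u) := by
    rw [Finset.mul_sum]
    refine Finset.sum_congr rfl fun u _ => ?_
    rw [show algebraMap (𝓞 B.K) B.K (B.sMat D' T S₀ r u) = ((B.sMat D' T S₀ r u : 𝓞 B.K) : B.K) from rfl,
      coe_sMat]
    rw [show algebraMap (𝓞 B.K) B.K (ξ u) = ((ξ u : 𝓞 B.K) : B.K) from rfl]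
    ring
  rw [e] at hr'
  exact (mul_eq_zero.mp hr').resolve_left (pow_ne_zero _ (B.dAt_ne_zero _))

/-! ### The house bound of the entries -/

omit [DecidableEq β] [DecidableEq δ] in
/-- `|d₁| ≥ 1` (indeed `≥ 2`). [folklore] -/
theorem one_le_abs_d₁ : (1 : ℝ) ≤ |(B.d₁ : ℝ)| := by
  have h := B.gens.one_le_abs_den
  have e : (B.d₁ : ℝ) = 2 * (B.den : ℝ) := by simp [d₁]
  rw [e, abs_mul, abs_two]
  nlinarith [abs_nonneg (B.den : ℝ)]

omit [DecidableEq β] [DecidableEq δ] in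
/-- `expE` is monotone in `k`. [folklore] -/
theorem expE_mono (D : ℕ) {k k' : ℕ} (h : k ≤ k') : B.expE D k ≤ B.expE D k' := by
  unfold expE; omega

/-- **The denominator bound at `s·v`**: `dB s = |d₁| · gBound(s)^{#Gen} ≥ |d_s|`. [folklore] -/
def dB (s : ℕ) : ℝ := |(B.d₁ : ℝ)| * B.gBound s ^ Fintype.card (Gen β γ δ)

omit [DecidableEq β] [DecidableEq δ] in
/-- `|d_s| ≤ dB s`. [folklore] -/
theorem abs_dAt_le_dB (s : ℕ) : |(B.dAt s : ℝ)| ≤ B.dB s := B.abs_dAt_le s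

omit [DecidableEq β] [DecidableEq δ] in
/-- `1 ≤ dB s`. [folklore] -/
theorem one_le_dB (s : ℕ) : 1 ≤ B.dB s := (B.one_le_abs_dAt s).trans (B.abs_dAt_le_dB s)

omit [DecidableEq β] [DecidableEq δ] in
/-- `dB` is monotone. [folklore] -/
theorem dB_mono {s s' : ℕ} (h : s ≤ s') : B.dB s ≤ B.dB s' :=
  mul_le_mul_of_nonneg_left (pow_le_pow_left₀ (zero_le_one.trans (B.one_le_gBound s)) (B.gBound_mono h) _)
    (abs_nonneg _)

/-- **The uniform house bound** of the Siegel matrix (explicit in `D = nD'`, `T`, `S₀`).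
[cite: BakerWustholz2007, §6.8 (p. 118: "algebraic integers with sizes at most …")] -/
def houseBound (D' T S₀ : ℕ) : ℝ :=
  B.dB S₀ ^ B.expE (Fintype.card (β ⊕ (γ ⊕ δ)) * D') T * ((B.dd : ℝ) + 1) ^ T *
    (((Fintype.card (β ⊕ (γ ⊕ δ)) * D' * B.hdeg : ℕ) : ℝ) + 2 * T + 1) ^ T * (max 1 B.qB) ^ T *
    B.hB ^ (Fintype.card (β ⊕ (γ ⊕ δ)) * D') *
    B.gBound S₀ ^ (Fintype.card (β ⊕ (γ ⊕ δ)) * D' * B.hdeg + 2 * T)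

omit [DecidableEq β] [DecidableEq δ] in
/-- `1 ≤ houseBound`. [folklore] -/
theorem one_le_houseBound (D' T S₀ : ℕ) : 1 ≤ B.houseBound D' T S₀ := by
  unfold houseBound
  have h1 := B.one_le_dB S₀
  have h2 : (1 : ℝ) ≤ (B.dd : ℝ) + 1 := by have : (0:ℝ) ≤ B.dd := Nat.cast_nonneg _; linarith
  have h3 : (1 : ℝ) ≤ (((Fintype.card (β ⊕ (γ ⊕ δ)) * D' * B.hdeg : ℕ) : ℝ) + 2 * T + 1) := by
    have : (0:ℝ) ≤ ((Fintype.card (β ⊕ (γ ⊕ δ)) * D' * B.hdeg : ℕ) : ℝ) := Nat.cast_nonneg _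
    have : (0:ℝ) ≤ T := Nat.cast_nonneg _
    linarith
  have h4 : (1 : ℝ) ≤ max 1 B.qB := le_max_left _ _
  have h5 := B.one_le_hB
  have h6 := B.one_le_gBound S₀
  have hAB := one_le_mul_of_one_le_of_one_le (one_le_pow₀ (n := B.expE (Fintype.card (β ⊕ (γ ⊕ δ)) * D') T) h1)
    (one_le_pow₀ (n := T) h2)
  have hABC := one_le_mul_of_one_le_of_one_le hAB (one_le_pow₀ (n := T) h3)
  have h4' := one_le_mul_of_one_le_of_one_le hABC (one_le_pow₀ (n := T) h4)
  have h5' := one_le_mul_of_one_le_of_one_le h4' (one_le_pow₀ (n := Fintype.card (β ⊕ (γ ⊕ δ)) * D') h5)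
  exact one_le_mul_of_one_le_of_one_le h5' (one_le_pow₀ h6)

omit [DecidableEq β] [DecidableEq δ] in
/-- The number of words of content `α` and length `k` is at most `(dd+1)^T` for `k ≤ T`. [folklore] -/
theorem card_wordsOf_le (k : ℕ) {T : ℕ} (hk : k ≤ T) (α : Fin B.dd → Fin T) :
    ((B.wordsOf k α).card : ℝ) ≤ ((B.dd : ℝ) + 1) ^ T := by
  have h1 : (B.wordsOf k α).card ≤ B.dd ^ k := by
    refine (Finset.card_filter_le _ _).trans ?_
    simp [Finset.card_univ]
  have h2 : ((B.dd : ℝ)) ^ k ≤ ((B.dd : ℝ) + 1) ^ k :=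
    pow_le_pow_left₀ (Nat.cast_nonneg _) (by linarith) k
  have h3 : ((B.dd : ℝ) + 1) ^ k ≤ ((B.dd : ℝ) + 1) ^ T :=
    pow_le_pow_right₀ (by have : (0:ℝ) ≤ B.dd := Nat.cast_nonneg _; linarith) hk
  calc ((B.wordsOf k α).card : ℝ) ≤ ((B.dd ^ k : ℕ) : ℝ) := by exact_mod_cast h1
    _ = (B.dd : ℝ) ^ k := by push_cast; ring
    _ ≤ ((B.dd : ℝ) + 1) ^ T := h2.trans h3

omit [DecidableEq β] [DecidableEq δ] in
/-- **Every entry of the Siegel matrix has house `≤ houseBound`.**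
[cite: BakerWustholz2007, §6.8 (p. 118)] -/
theorem house_sMat_le (D' T S₀ : ℕ) (r : B.EIdx T S₀) (u : UIdx β γ δ D') :
    house ((B.sMat D' T S₀ r u : 𝓞 B.K) : B.K) ≤ B.houseBound D' T S₀ := by
  obtain ⟨⟨s, hs⟩, ⟨k, hk⟩, α⟩ := r
  set n := Fintype.card (β ⊕ (γ ⊕ δ)) with hn
  set D := n * D' with hD
  have hsS : s ≤ S₀ := Nat.lt_succ_iff.mp hs
  have hkT : k ≤ T := hk.le
  have hν : (νOf u).degree ≤ D := degree_νOf_le u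
  -- constants
  have hd1 := B.one_le_dB S₀
  have hMs1 : (1 : ℝ) ≤ B.gBound s := B.one_le_gBound s
  have hMS := B.one_le_gBound S₀
  have hhB := B.one_le_hB
  have hq1 : (1 : ℝ) ≤ max 1 B.qB := le_max_left _ _
  have hN1 : (1 : ℝ) ≤ (((D * B.hdeg : ℕ) : ℝ) + 2 * T + 1) := by
    have : (0:ℝ) ≤ ((D * B.hdeg : ℕ) : ℝ) := Nat.cast_nonneg _
    have : (0:ℝ) ≤ T := Nat.cast_nonneg _
    linarith
  -- the bound for one entry value, made uniform
  have hentry : ∀ (σ : B.K →+* ℂ) (ω : Fin k → Fin B.dd),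
      ‖σ (B.entryVal s ω D (νOf u))‖ ≤ (((D * B.hdeg : ℕ) : ℝ) + 2 * T + 1) ^ T * (max 1 B.qB) ^ T *
        B.hB ^ D * B.gBound S₀ ^ (D * B.hdeg + 2 * T) := by
    intro σ ω
    refine (B.entryVal_bounds σ s ω hν).1.trans ?_
    have e1 : (((D * B.hdeg : ℕ) : ℝ) + 2 * k) ^ k ≤ (((D * B.hdeg : ℕ) : ℝ) + 2 * T + 1) ^ T := by
      refine (pow_le_pow_left₀ (by positivity) ?_ k).trans (pow_le_pow_right₀ hN1 hkT)
      have : (k : ℝ) ≤ T := by exact_mod_cast hkT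
      linarith
    have e2 : B.qB ^ k ≤ (max 1 B.qB) ^ T :=
      (pow_le_pow_left₀ B.qB_nonneg (le_max_right _ _) k).trans (pow_le_pow_right₀ hq1 hkT)
    have e3 : B.gBound s ^ (D * B.hdeg + 2 * k) ≤ B.gBound S₀ ^ (D * B.hdeg + 2 * T) := by
      have hbase : B.gBound s ≤ B.gBound S₀ := B.gBound_mono hsS
      exact (pow_le_pow_left₀ (by positivity) hbase _).trans (pow_le_pow_right₀ hMS (by omega))
    have hB0 : 0 ≤ B.hB ^ D := pow_nonneg (zero_le_one.trans hhB) _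
    exact mul_le_mul (mul_le_mul (mul_le_mul e1 e2 (pow_nonneg B.qB_nonneg _) (by positivity)) le_rfl hB0
      (by positivity)) e3 (by positivity) (by positivity)
  -- assemble
  refine B.gens.house_le_of_forall_norm_le (zero_le_one.trans (B.one_le_houseBound D' T S₀)) fun σ => ?_
  rw [coe_sMat]
  simp only
  rw [map_mul, map_pow, norm_mul, norm_pow]
  have hdcast : ‖σ ((B.dAt s : ℤ) : B.K)‖ ≤ B.dB S₀ := by
    rw [map_intCast, Complex.norm_intCast]
    exact (B.abs_dAt_le_dB s).trans (B.dB_mono hsS)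
  have hrow : ‖σ (B.rowSum D s k α (νOf u))‖ ≤ ((B.dd : ℝ) + 1) ^ T *
      ((((D * B.hdeg : ℕ) : ℝ) + 2 * T + 1) ^ T * (max 1 B.qB) ^ T * B.hB ^ D *
        B.gBound S₀ ^ (D * B.hdeg + 2 * T)) := by
    rw [rowSum, map_sum]
    refine (norm_sum_le _ _).trans ?_
    refine (Finset.sum_le_sum fun ω _ => hentry σ ω).trans ?_
    rw [Finset.sum_const, nsmul_eq_mul]
    refine mul_le_mul_of_nonneg_right (B.card_wordsOf_le k hkT α) ?_
    have := B.one_le_gBound S₀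
    positivity
  have hdpow : ‖σ ((B.dAt s : ℤ) : B.K)‖ ^ B.expE D k ≤ B.dB S₀ ^ B.expE D T :=
    (pow_le_pow_left₀ (norm_nonneg _) hdcast _).trans (pow_le_pow_right₀ hd1 (B.expE_mono D hkT))
  unfold houseBound
  rw [← hn, ← hD]
  have h0 : 0 ≤ B.dB S₀ ^ B.expE D T := by have := B.one_le_dB S₀; positivity
  refine (mul_le_mul hdpow hrow (norm_nonneg _) h0).trans (le_of_eq ?_)
  push_cast
  ring

end BakerDataG

end Std

end GaGmE

end Literature.NumberTheory.Transcendental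

end

/-!
# The auxiliary function, line values and the Liouville step at a general algebraic point

Topic: `Literature/NumberTheory/Transcendental`. Unit
`provefact-Literature.NumberTheory.Transcendental.s-efcbe22610` (fact `semistabilityTheorem_std`).
For the general-point data `BakerDataG` (`BakerFieldG.lean` … `SiegelSystemG.lean`) this file is
the verbatim port of the `BakerData` parts of `AuxiliaryFunction.lean` (the auxiliary form
`QOf`, `homog_QOf`, `wordForm_homogMonomial`), `LineValues.lean` (the polynomial `p_{s,k}`:
`lineValPoly`, `emb_coeff_lineValPoly`, `iteratedDeriv_grid_eq`), `AuxiliaryFunctionSharp.lean`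
(the sharp Siegel system `sMat₂`, `exists_auxiliary₂`) and `LiouvilleStep.lean` (integrality,
`lineValBound`, `norm_embedding_lineVal_le`, `one_le_of_lineVal_ne_zero`,
`lineVal_eq_zero_of_norm_lt`). The generic statements of those files (`BakerData.wordForm_sum`,
`BakerData.card_UIdx`, `PolyODE.sum_content`, the first-jet formulas of `LineValues.lean`) are
imported and reused. The only change is the conjugate bound `gBound s` in `lineValBound` in place
of `(s+1)M^{s+1}`. Everything is proved; no named facts.

## References

* A. Baker, G. Wüstholz, *Logarithmic Forms and Diophantine Geometry*, CUP 2007, §6.8 (pp. 118–119).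
* A. Baker, *Transcendental Number Theory*, CUP 1975, Ch. 2, Lemma 5.
-/

noncomputable section

open Complex Filter Topology MvPolynomial Finset NumberField
open Literature.NumberTheory.Transcendental.ArithPoly
open Literature.NumberTheory.Transcendental.Chudnovsky
open scoped PeriodPair

namespace Literature.NumberTheory.Transcendental

namespace GaGmE

namespace Std

namespace BakerDataG

open BakerData (UIdx νOf νOf_apply νOf_injective degree_νOf_le wordForm_sum card_UIdx)

variable {β γ δ : Type} [Fintype β] [Fintype γ] [Fintype δ] [DecidableEq γ]
variable [DecidableEq β] [DecidableEq δ] (B : BakerDataG β γ δ)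

/-! ### The auxiliary form -/

/-- The polynomial `Q = ∑_u ξ_u X^{νOf u}` attached to a vector of coefficients. [folklore] -/
def QOf {D' : ℕ} (ξ : UIdx β γ δ D' → 𝓞 B.K) : MvPolynomial (β ⊕ (γ ⊕ δ)) ℂ :=
  ∑ u, monomial (νOf u) (B.emb (ξ u : B.K))

/-- `coeff (νOf u) (QOf ξ) = ξ_u`. [folklore] -/
theorem coeff_QOf {D' : ℕ} (ξ : UIdx β γ δ D' → 𝓞 B.K) (u : UIdx β γ δ D') :
    coeff (νOf u) (B.QOf ξ) = B.emb (ξ u : B.K) := by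
  rw [QOf, coeff_sum]
  simp only [coeff_monomial]
  rw [Finset.sum_eq_single u]
  · simp
  · intro u' _ hu'
    rw [if_neg]
    exact fun h => hu' (νOf_injective h)
  · intro h; exact absurd (Finset.mem_univ u) h

/-- `QOf ξ ≠ 0` for `ξ ≠ 0`. [folklore] -/
theorem QOf_ne_zero {D' : ℕ} {ξ : UIdx β γ δ D' → 𝓞 B.K} (hξ : ξ ≠ 0) : B.QOf ξ ≠ 0 := by
  obtain ⟨u, hu⟩ := Function.ne_iff.mp hξ
  intro h
  have hc := B.coeff_QOf ξ u
  rw [h, coeff_zero] at hc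
  have h1 : (ξ u : B.K) = 0 := by
    have : B.emb (ξ u : B.K) = 0 := hc.symm
    exact (map_eq_zero_iff B.emb (algebraMap B.K ℂ).injective).mp this
  exact hu (RingOfIntegers.coe_eq_zero_iff.mp h1)

/-- `deg QOf ≤ n·D'`. [folklore] -/
theorem totalDegree_QOf_le {D' : ℕ} (ξ : UIdx β γ δ D' → 𝓞 B.K) :
    (B.QOf ξ).totalDegree ≤ Fintype.card (β ⊕ (γ ⊕ δ)) * D' := by
  rw [QOf]
  refine (totalDegree_finsetSum _ _).trans (Finset.sup_le fun u _ => ?_)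
  refine (totalDegree_monomial_le _ _).trans ?_
  have h := degree_νOf_le u
  rw [Finsupp.degree] at h
  exact h

/-- `homog D (QOf ξ) = ∑_u ξ_u · homogMonomial D (νOf u)` (`D = nD'`). [folklore] -/
theorem homog_QOf {D' : ℕ} (ξ : UIdx β γ δ D' → 𝓞 B.K) :
    homog (Fintype.card (β ⊕ (γ ⊕ δ)) * D') (B.QOf ξ) =
      ∑ u, C (B.emb (ξ u : B.K)) * homogMonomialᵣ (Fintype.card (β ⊕ (γ ⊕ δ)) * D') (νOf u) := by
  rw [QOf, homog_sum]
  exact Finset.sum_congr rfl fun u _ => homog_monomial (degree_νOf_le u) _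

omit [DecidableEq β] [DecidableEq δ] in
/-- **The word forms of a homogenised monomial are the entries** (base change):
`Λ_ω(homogMonomial D ν)` at `s·v` in the chart `c_s` is `emb (entryVal s ω D ν)`. [folklore] -/
theorem wordForm_homogMonomial (s D : ℕ) {k : ℕ} (ω : Fin k → Fin B.dd) (ν : (β ⊕ (γ ⊕ δ)) →₀ ℕ) :
    wordForm B.L B.κM (B.cAt s) B.xs ((s : ℂ) • B.v) ω (homogMonomialᵣ D ν) = B.emb (B.entryVal s ω D ν) := by
  have h := wordForm_eq_map (β := β) B.emb B.L B.κM (g2 := B.g2K) (g3 := B.g3K) rfl rfl (κ := B.κK)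
    (fun _ _ => rfl) (B.cAt s) (xs := B.xs) (xK := B.xK) (fun _ _ => rfl) (w := (s : ℂ) • B.v)
    (gK := B.gK s) (fun i => B.emb_gK s 0 i) (P := homogMonomialᵣ D ν) (PK := homogMonomialᵣ D ν)
    (map_homogMonomialᵣ _ _ _) ω
  rw [h]
  rfl


/-! ### The polynomial `p_{s,k}` of the line values -/

/-- The content of a word as a finitely supported function. [folklore] -/
def contentFs {k : ℕ} (ω : Fin k → Fin B.dd) : Fin B.dd →₀ ℕ :=
  Finsupp.equivFunOnFinite.symm (PolyODE.content ω)

omit [DecidableEq β] [DecidableEq δ] in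
/-- `contentFs ω m = content ω m`. [folklore] -/
@[simp] theorem contentFs_apply {k : ℕ} (ω : Fin k → Fin B.dd) (m : Fin B.dd) :
    B.contentFs ω m = PolyODE.content ω m := by
  simp [contentFs]

/-- **The polynomial `p_{s,k} ∈ K[c_1,…,c_dd]`** whose values at grid points are the normalised
line jets: `p_{s,k} = ∑_ω X^{content ω} · ∑_u ξ_u · entryVal s ω D (νOf u)` (`D = nD'`).
[cite: BakerWustholz2007, §6.8 (p. 119)] -/
def lineValPoly {D' : ℕ} (ξ : UIdx β γ δ D' → 𝓞 B.K) (s k : ℕ) : MvPolynomial (Fin B.dd) B.K :=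
  ∑ ω : Fin k → Fin B.dd, monomial (B.contentFs ω)
    (∑ u, (ξ u : B.K) * B.entryVal s ω (Fintype.card (β ⊕ (γ ⊕ δ)) * D') (νOf u))

/-- `deg_{c_m} p_{s,k} ≤ k`. [folklore] -/
theorem degreeOf_lineValPoly_le {D' : ℕ} (ξ : UIdx β γ δ D' → 𝓞 B.K) (s k : ℕ) (m : Fin B.dd) :
    (B.lineValPoly ξ s k).degreeOf m ≤ k := by
  rw [lineValPoly, MvPolynomial.degreeOf_le_iff]
  intro α hα
  obtain ⟨ω, -, hω⟩ := Finset.mem_biUnion.mp (MvPolynomial.support_sum hα)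
  have hsub := MvPolynomial.support_monomial_subset hω
  rw [Finset.mem_singleton] at hsub
  rw [hsub, contentFs_apply]
  exact PolyODE.content_le ω m

/-- The word forms of `P = homog D (QOf ξ)` at `s·v` are `emb(∑_u ξ_u · entryVal s ω D (νOf u))`.
[folklore] -/
theorem wordForm_homog_QOf {D' : ℕ} (ξ : UIdx β γ δ D' → 𝓞 B.K) (s : ℕ) {k : ℕ} (ω : Fin k → Fin B.dd) :
    wordForm B.L B.κM (B.cAt s) B.xs ((s : ℂ) • B.v) ω
        (homog (Fintype.card (β ⊕ (γ ⊕ δ)) * D') (B.QOf ξ)) =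
      B.emb (∑ u, (ξ u : B.K) * B.entryVal s ω (Fintype.card (β ⊕ (γ ⊕ δ)) * D') (νOf u)) := by
  rw [homog_QOf, wordForm_sum, map_sum]
  refine Finset.sum_congr rfl fun u _ => ?_
  rw [← smul_eq_C_mul, wordForm_smul, wordForm_homogMonomial, map_mul]

/-- **The coefficients of `p_{s,k}` are the content sums of word forms**: for a content
`α : Fin dd → ℕ`, `emb(coeff_α p_{s,k}) = ∑_{ω of content α} Λ_ω(P)` at `s·v`. [folklore] -/
theorem emb_coeff_lineValPoly {D' : ℕ} (ξ : UIdx β γ δ D' → 𝓞 B.K) (s k : ℕ) (α : Fin B.dd → ℕ) :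
    B.emb (coeff (Finsupp.equivFunOnFinite.symm α) (B.lineValPoly ξ s k)) =
      ∑ ω ∈ Finset.univ.filter (fun ω : Fin k → Fin B.dd => ∀ m, PolyODE.content ω m = α m),
        wordForm B.L B.κM (B.cAt s) B.xs ((s : ℂ) • B.v) ω
          (homog (Fintype.card (β ⊕ (γ ⊕ δ)) * D') (B.QOf ξ)) := by
  rw [lineValPoly, coeff_sum, map_sum, Finset.sum_filter]
  refine Finset.sum_congr rfl fun ω _ => ?_
  rw [coeff_monomial]
  have hiff : (B.contentFs ω = Finsupp.equivFunOnFinite.symm α) ↔ ∀ m, PolyODE.content ω m = α m := by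
    constructor
    · intro h m
      have := congrArg (fun f => f m) h
      simpa [contentFs] using this
    · intro h
      ext m
      simp [contentFs, h m]
  by_cases h : ∀ m, PolyODE.content ω m = α m
  · rw [if_pos (hiff.mpr h), if_pos h, wordForm_homog_QOf]
  · rw [if_neg (fun h' => h (hiff.mp h')), if_neg h, map_zero]

/-- **The normalised line jets at `s·v` along grid directions.** For `c : Fin dd → ℕ` and
`x_c = ∑ c_m x_m`: if the line jets of `F_P` (`P = homog D (QOf ξ)`) at `s·v` along `x_c` of
orders `< k` vanish, then `φ_{x_c,k}(s) = Θ_{J₀(c_s)}(s·v)^D · emb(p_{s,k}(c))`.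
[cite: BakerWustholz2007, §6.8 (p. 119)] -/
theorem iteratedDeriv_grid_eq {D' : ℕ} (ξ : UIdx β γ δ D' → 𝓞 B.K) (s k : ℕ) (cg : Fin B.dd → ℕ)
    (hlow : ∀ i < k, iteratedDeriv i (fun t : ℂ => thetaEval B.L B.κM
      (homog (Fintype.card (β ⊕ (γ ⊕ δ)) * D') (B.QOf ξ)) ((s : ℂ) • B.v + t • ∑ m, (cg m : ℂ) • B.xs m)) 0 = 0) :
    iteratedDeriv k (fun t : ℂ => thetaEval B.L B.κM
        (homog (Fintype.card (β ⊕ (γ ⊕ δ)) * D') (B.QOf ξ)) ((s : ℂ) • B.v + t • ∑ m, (cg m : ℂ) • B.xs m)) 0 =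
      theta B.L B.κM (baseIdx (B.cAt s)) ((s : ℂ) • B.v) ^ (Fintype.card (β ⊕ (γ ⊕ δ)) * D') *
        B.emb (MvPolynomial.eval (fun m => (cg m : B.K)) (B.lineValPoly ξ s k)) := by
  rw [iteratedDeriv_thetaEval_line_sum_eq B.L B.κM (isHomogeneous_homog _ _) (B.cAt s)
    (fun x => zero_mem_chartDomain_chartChoiceAt B.L _ x) B.xs (fun m => (cg m : ℂ)) hlow]
  congr 1
  rw [lineValPoly, map_sum, map_sum]
  refine Finset.sum_congr rfl fun ω _ => ?_
  rw [MvPolynomial.eval_monomial, map_mul, wordForm_homog_QOf, mul_comm (B.emb _)]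
  congr 1
  rw [Finsupp.prod_fintype _ _ (fun m => by simp), map_prod]
  simp only [contentFs_apply, map_pow, map_natCast]
  rw [PolyODE.prod_word_eq_prod_pow_content (fun m => (cg m : ℂ))]


/-! ### The sharp system -/

omit [DecidableEq β] [DecidableEq δ] in
/-- The equations: `(s, α)` with `s ≤ S₀` and a content `α : Fin dd → Fin T`. [folklore] -/
abbrev EIdx₂ (T S₀ : ℕ) : Type := Fin (S₀ + 1) × (Fin B.dd → Fin T)

omit [DecidableEq β] [DecidableEq δ] in
/-- The order of the row `(s, α)`: `|α| = ∑_m α_m`. [folklore] -/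
def rowOrder {T : ℕ} (α : Fin B.dd → Fin T) : ℕ := ∑ m, (α m : ℕ)

omit [DecidableEq β] [DecidableEq δ] in
/-- **The sharp Siegel matrix**: the row `(s, α)` is `d_s^{E(D,|α|)} · ∑_{content α} entryVal`
when `|α| < T`, and zero otherwise. [cite: BakerWustholz2007, §6.8 (p. 118)] -/
def sMat₂ (D' T S₀ : ℕ) : Matrix (B.EIdx₂ T S₀) (UIdx β γ δ D') (𝓞 B.K) := fun r u =>
  if B.rowOrder r.2 < T then
    ⟨(B.dAt r.1 : B.K) ^ B.expE (Fintype.card (β ⊕ (γ ⊕ δ)) * D') (B.rowOrder r.2) *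
        B.rowSum (Fintype.card (β ⊕ (γ ⊕ δ)) * D') r.1 (B.rowOrder r.2) r.2 (νOf u),
      B.isIntegral_rowSum _ _ _ _ (degree_νOf_le u)⟩
  else 0

omit [DecidableEq β] [DecidableEq δ] in
/-- Cardinality of the equations: `(S₀+1)·T^{dd}`. [folklore] -/
theorem card_EIdx₂ (T S₀ : ℕ) : Fintype.card (B.EIdx₂ T S₀) = (S₀ + 1) * T ^ B.dd := by
  simp [EIdx₂]

omit [DecidableEq β] [DecidableEq δ] in
/-- The entries of the sharp matrix have house `≤ houseBound` (they are entries of the matrix of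
`SiegelSystem.lean`, or zero). [folklore] -/
theorem house_sMat₂_le (D' T S₀ : ℕ) (r : B.EIdx₂ T S₀) (u : UIdx β γ δ D') :
    house ((B.sMat₂ D' T S₀ r u : 𝓞 B.K) : B.K) ≤ B.houseBound D' T S₀ := by
  unfold sMat₂
  split_ifs with h
  · have := B.house_sMat_le D' T S₀ (r.1, ⟨B.rowOrder r.2, h⟩, r.2) u
    simpa [sMat] using this
  · have h0 : house ((0 : 𝓞 B.K) : B.K) = 0 := by simp [house]
    rw [h0]
    exact zero_le_one.trans (B.one_le_houseBound D' T S₀)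

/-- A solution of the sharp system kills the row sums of the rows of order `< T`. [folklore] -/
theorem rowSum_eq_zero_of_mulVec₂ {D' T S₀ : ℕ} {ξ : UIdx β γ δ D' → 𝓞 B.K}
    (h : (B.sMat₂ D' T S₀).mulVec ξ = 0) (r : B.EIdx₂ T S₀) (hr : B.rowOrder r.2 < T) :
    ∑ u, (ξ u : B.K) * B.rowSum (Fintype.card (β ⊕ (γ ⊕ δ)) * D') r.1 (B.rowOrder r.2) r.2 (νOf u) = 0 := by
  have hrow := congrFun h r
  simp only [Matrix.mulVec, dotProduct, Pi.zero_apply] at hrow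
  have hrow' := congrArg (algebraMap (𝓞 B.K) B.K) hrow
  rw [map_sum, map_zero] at hrow'
  simp only [map_mul] at hrow'
  have e : ∑ u, algebraMap (𝓞 B.K) B.K (B.sMat₂ D' T S₀ r u) * algebraMap (𝓞 B.K) B.K (ξ u) =
      (B.dAt r.1 : B.K) ^ B.expE (Fintype.card (β ⊕ (γ ⊕ δ)) * D') (B.rowOrder r.2) *
        ∑ u, (ξ u : B.K) * B.rowSum (Fintype.card (β ⊕ (γ ⊕ δ)) * D') r.1 (B.rowOrder r.2) r.2 (νOf u) := by
    rw [Finset.mul_sum]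
    refine Finset.sum_congr rfl fun u _ => ?_
    rw [show algebraMap (𝓞 B.K) B.K (B.sMat₂ D' T S₀ r u) = ((B.sMat₂ D' T S₀ r u : 𝓞 B.K) : B.K) from rfl,
      show algebraMap (𝓞 B.K) B.K (ξ u) = ((ξ u : 𝓞 B.K) : B.K) from rfl]
    simp only [sMat₂, if_pos hr]
    show ((B.dAt r.1 : B.K) ^ _ * B.rowSum _ _ _ _ _) * _ = _
    ring
  rw [e] at hrow'
  exact (mul_eq_zero.mp hrow').resolve_left (pow_ne_zero _ (B.dAt_ne_zero _))

/-- **The sharp system encodes the vanishing conditions.** [cite: BakerWustholz2007, §6.8 (p. 118)] -/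
theorem vanishesAlong_of_mulVec₂ {D' T S₀ : ℕ} {ξ : UIdx β γ δ D' → 𝓞 B.K}
    (h : (B.sMat₂ D' T S₀).mulVec ξ = 0) {s : ℕ} (hs : s ≤ S₀) :
    VanishesAlong (Submodule.span ℂ (Set.range B.xs))
      (thetaEval B.L B.κM (homog (Fintype.card (β ⊕ (γ ⊕ δ)) * D') (B.QOf ξ))) ((s : ℂ) • B.v) T := by
  set D := Fintype.card (β ⊕ (γ ⊕ δ)) * D' with hD
  refine vanishesAlong_span_of_wordForms B.L B.κM (isHomogeneous_homog D _) (B.cAt s)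
    (fun x => zero_mem_chartDomain_chartChoiceAt B.L _ x) B.xs T fun k hk α => ?_
  -- word forms of `P`
  have hP : ∀ ω : Fin k → Fin B.dd, wordForm B.L B.κM (B.cAt s) B.xs ((s : ℂ) • B.v) ω (homog D (B.QOf ξ)) =
      B.emb (∑ u, (ξ u : B.K) * B.entryVal s ω D (νOf u)) := fun ω => B.wordForm_homog_QOf ξ s ω
  by_cases hsum : ∑ m, (α m : ℕ) = k
  · -- the row `(s, α)` of order `k`
    let α' : Fin B.dd → Fin T := fun m => ⟨α m, lt_of_lt_of_le (α m).isLt (Nat.succ_le_of_lt hk)⟩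
    have hord : B.rowOrder α' = k := by simp [rowOrder, α', hsum]
    have hrow := B.rowSum_eq_zero_of_mulVec₂ h (⟨s, Nat.lt_succ_of_le hs⟩, α') (by rw [hord]; exact hk)
    simp only [hord] at hrow
    have hset : Finset.univ.filter (fun ω : Fin k → Fin B.dd => ∀ m, PolyODE.content ω m = α m) =
        B.wordsOf k α' := by
      ext ω; simp [wordsOf, α']
    rw [Finset.sum_congr rfl fun ω _ => hP ω, ← map_sum, hset]
    rw [show ∑ ω ∈ B.wordsOf k α', ∑ u, (ξ u : B.K) * B.entryVal s ω D (νOf u) =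
        ∑ u, (ξ u : B.K) * B.rowSum D s k α' (νOf u) from by
      rw [Finset.sum_comm]
      refine Finset.sum_congr rfl fun u _ => ?_
      rw [rowSum, Finset.mul_sum]]
    rw [hrow, map_zero]
  · -- no word of length `k` has content `α`
    refine Finset.sum_eq_zero fun ω hω => ?_
    exfalso
    apply hsum
    have hc := (Finset.mem_filter.mp hω).2
    calc ∑ m, (α m : ℕ) = ∑ m, PolyODE.content ω m := Finset.sum_congr rfl fun m _ => (hc m).symm
      _ = k := PolyODE.sum_content ω

/-- **The auxiliary function with the sharp count.** For `T ≥ 1` and `(S₀+1)·T^{dd} < (D'+1)^n`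
there is `ξ ≠ 0` in `𝓞 K^{unknowns}` within the Siegel house bound such that `P = homog (nD') (QOf ξ)`
has `F_P ≢ 0` and vanishes to order `≥ T` along `𝔟` at `s·v`, `s ≤ S₀`.
[cite: BakerWustholz2007, §6.8 (pp. 118–119)] -/
theorem exists_auxiliary₂ (D' T S₀ : ℕ) (hT : 0 < T)
    (hpq : (S₀ + 1) * T ^ B.dd < (D' + 1) ^ Fintype.card (β ⊕ (γ ⊕ δ))) :
    ∃ ξ : UIdx β γ δ D' → 𝓞 B.K, ξ ≠ 0 ∧
      (∀ u, house ((ξ u : 𝓞 B.K) : B.K) ≤ siegelConst B.K *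
        (siegelConst B.K * ((D' + 1) ^ Fintype.card (β ⊕ (γ ⊕ δ)) : ℕ) * B.houseBound D' T S₀) ^
          ((((S₀ + 1) * T ^ B.dd : ℕ) : ℝ) /
            ((((D' + 1) ^ Fintype.card (β ⊕ (γ ⊕ δ)) : ℕ) : ℝ) - ((S₀ + 1) * T ^ B.dd : ℕ)))) ∧
      (∃ w, thetaEval B.L B.κM (homog (Fintype.card (β ⊕ (γ ⊕ δ)) * D') (B.QOf ξ)) w ≠ 0) ∧
      ∀ s ≤ S₀, VanishesAlong (Submodule.span ℂ (Set.range B.xs))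
        (thetaEval B.L B.κM (homog (Fintype.card (β ⊕ (γ ⊕ δ)) * D') (B.QOf ξ))) ((s : ℂ) • B.v) T := by
  have h0p : 0 < (S₀ + 1) * T ^ B.dd := Nat.mul_pos (Nat.succ_pos _) (pow_pos hT _)
  obtain ⟨ξ, hξ, hmul, hhouse⟩ := siegel_house B.K (B.sMat₂ D' T S₀) h0p hpq (B.card_EIdx₂ T S₀) (card_UIdx D')
    (B.one_le_houseBound D' T S₀) (fun r u => B.house_sMat₂_le D' T S₀ r u)
  refine ⟨ξ, hξ, fun u => hhouse u, ?_, fun s hs => B.vanishesAlong_of_mulVec₂ hmul hs⟩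
  exact exists_thetaEval_homog_ne_zero B.κM (B.QOf_ne_zero hξ) (B.totalDegree_QOf_le ξ)


/-! ### Integrality -/

/-- **`d_s^{E(D,k)} · p_{s,k}(c) ∈ 𝓞 K`** (`D = nD'`). [folklore] -/
theorem intZ_lineVal {D' : ℕ} (ξ : UIdx β γ δ D' → 𝓞 B.K) (s k : ℕ) (cg : Fin B.dd → ℕ) :
    B.IntZ ((B.dAt s : B.K) ^ B.expE (Fintype.card (β ⊕ (γ ⊕ δ)) * D') k *
      MvPolynomial.eval (fun m => (cg m : B.K)) (B.lineValPoly ξ s k)) := by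
  show IsIntegral ℤ _
  rw [lineValPoly, map_sum, Finset.mul_sum]
  refine IsIntegral.sum _ fun ω _ => ?_
  rw [MvPolynomial.eval_monomial, ← mul_assoc]
  refine IsIntegral.mul ?_ ?_
  · rw [Finset.mul_sum]
    refine IsIntegral.sum _ fun u _ => ?_
    rw [mul_left_comm]
    exact IsIntegral.mul (ξ u).2 (B.entryVal_bounds B.emb s ω (degree_νOf_le u)).2
  · rw [Finsupp.prod_fintype _ _ (fun m => by simp)]
    refine IsIntegral.prod _ fun m _ => IsIntegral.pow ?_ _
    exact_mod_cast isIntegral_algebraMap (R := ℤ) (A := B.K) (x := (cg m : ℤ))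

/-! ### Sizes of the conjugates -/

/-- A common bound for the houses of the coefficients `ξ_u`: `H_ξ = 1 + ∑_u house(ξ_u)`.
[folklore] -/
def houseXi {D' : ℕ} (ξ : UIdx β γ δ D' → 𝓞 B.K) : ℝ := 1 + ∑ u, house ((ξ u : 𝓞 B.K) : B.K)

/-- `1 ≤ H_ξ`. [folklore] -/
theorem one_le_houseXi {D' : ℕ} (ξ : UIdx β γ δ D' → 𝓞 B.K) : 1 ≤ B.houseXi ξ := by
  have : 0 ≤ ∑ u, house ((ξ u : 𝓞 B.K) : B.K) := Finset.sum_nonneg fun u _ => house_nonneg _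
  unfold houseXi; linarith

/-- Every conjugate of every `ξ_u` is at most `H_ξ`. [folklore] -/
theorem norm_embedding_xi_le {D' : ℕ} (ξ : UIdx β γ δ D' → 𝓞 B.K) (σ : B.K →+* ℂ) (u : UIdx β γ δ D') :
    ‖σ ((ξ u : 𝓞 B.K) : B.K)‖ ≤ B.houseXi ξ := by
  refine (norm_embedding_le_house _ σ).trans ?_
  have h1 : house ((ξ u : 𝓞 B.K) : B.K) ≤ ∑ u', house ((ξ u' : 𝓞 B.K) : B.K) :=
    Finset.single_le_sum (f := fun u' => house ((ξ u' : 𝓞 B.K) : B.K)) (fun _ _ => house_nonneg _)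
      (Finset.mem_univ u)
  unfold houseXi; linarith

/-- The bound for the conjugates of `p_{s,k}(c)`. [folklore] -/
def lineValBound {D' : ℕ} (ξ : UIdx β γ δ D' → 𝓞 B.K) (s k : ℕ) : ℝ :=
  (B.dd : ℝ) ^ k * (k : ℝ) ^ k * (Fintype.card (UIdx β γ δ D') : ℝ) * B.houseXi ξ *
    ((((Fintype.card (β ⊕ (γ ⊕ δ)) * D' * B.hdeg : ℕ) : ℝ) + 2 * k) ^ k * B.qB ^ k *
      B.hB ^ (Fintype.card (β ⊕ (γ ⊕ δ)) * D') *
        B.gBound s ^ (Fintype.card (β ⊕ (γ ⊕ δ)) * D' * B.hdeg + 2 * k))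

/-- `0 ≤ lineValBound`. [folklore] -/
theorem lineValBound_nonneg {D' : ℕ} (ξ : UIdx β γ δ D' → 𝓞 B.K) (s k : ℕ) : 0 ≤ B.lineValBound ξ s k := by
  unfold lineValBound
  have := B.one_le_houseXi ξ
  have := B.qB_nonneg
  have := B.one_le_hB
  have := B.one_le_gBound s
  positivity

/-- **All conjugates of `p_{s,k}(c)` are at most `lineValBound`** (for `c_m ≤ k`).
[cite: BakerWustholz2007, §6.8 (p. 119)] -/
theorem norm_embedding_lineVal_le {D' : ℕ} (ξ : UIdx β γ δ D' → 𝓞 B.K) (s k : ℕ) {cg : Fin B.dd → ℕ}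
    (hcg : ∀ m, cg m ≤ k) (σ : B.K →+* ℂ) :
    ‖σ (MvPolynomial.eval (fun m => (cg m : B.K)) (B.lineValPoly ξ s k))‖ ≤ B.lineValBound ξ s k := by
  set n := Fintype.card (β ⊕ (γ ⊕ δ)) with hn
  set D := n * D' with hD
  -- the entry bound
  set Eb : ℝ := ((((D * B.hdeg : ℕ) : ℝ) + 2 * k) ^ k * B.qB ^ k * B.hB ^ D *
    B.gBound s ^ (D * B.hdeg + 2 * k)) with hEb
  have hEb0 : 0 ≤ Eb := by
    have := B.qB_nonneg; have := B.one_le_hB; have := B.one_le_gBound s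
    positivity
  have hHξ := B.one_le_houseXi ξ
  -- one word
  have hword : ∀ ω : Fin k → Fin B.dd,
      ‖σ (MvPolynomial.eval (fun m => (cg m : B.K)) (monomial (B.contentFs ω)
        (∑ u, (ξ u : B.K) * B.entryVal s ω D (νOf u))))‖ ≤
        (k : ℝ) ^ k * ((Fintype.card (UIdx β γ δ D') : ℝ) * (B.houseXi ξ * Eb)) := by
    intro ω
    rw [MvPolynomial.eval_monomial, map_mul, norm_mul, mul_comm]
    refine mul_le_mul ?_ ?_ (norm_nonneg _) (by positivity)
    · -- `∏_m c_m^{content} = ∏_t c_{ω t} ≤ k^k`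
      rw [Finsupp.prod_fintype _ _ (fun m => by simp), map_prod, norm_prod]
      simp only [contentFs_apply, map_pow, map_natCast, norm_pow, Complex.norm_natCast]
      rw [← PolyODE.prod_word_eq_prod_pow_content (fun m => (cg m : ℝ)) ω]
      calc ∏ t, (cg (ω t) : ℝ) ≤ ∏ _t : Fin k, (k : ℝ) :=
            Finset.prod_le_prod (fun t _ => Nat.cast_nonneg _) fun t _ => by exact_mod_cast hcg (ω t)
        _ = (k : ℝ) ^ k := by simp
    · rw [map_sum]
      refine (norm_sum_le _ _).trans ?_
      refine (Finset.sum_le_sum fun u _ => ?_).trans (by rw [Finset.sum_const, nsmul_eq_mul, Finset.card_univ])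
      rw [map_mul, norm_mul]
      exact mul_le_mul (B.norm_embedding_xi_le ξ σ u) (B.entryVal_bounds σ s ω (degree_νOf_le u)).1
        (norm_nonneg _) (zero_le_one.trans hHξ)
  rw [lineValPoly, map_sum, map_sum]
  refine (norm_sum_le _ _).trans ?_
  refine (Finset.sum_le_sum fun ω _ => hword ω).trans ?_
  rw [Finset.sum_const, nsmul_eq_mul, Finset.card_univ, Fintype.card_fun, Fintype.card_fin, Fintype.card_fin]
  unfold lineValBound
  rw [← hn, ← hD, ← hEb]
  push_cast
  have : (0 : ℝ) ≤ (B.dd : ℝ) ^ k := by positivity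
  nlinarith [hEb0, hHξ, this]

/-! ### The Liouville inequality -/

/-- **Liouville step.** If `p_{s,k}(c) ≠ 0` then
`1 ≤ |emb(p_{s,k}(c))| · |d_s|^{E} · (|d_s|^{E} · lineValBound)^{h-1}`; contrapositively, a
smaller value forces `p_{s,k}(c) = 0`. [cite: Baker1975, Ch. 2 Lemma 5] -/
theorem one_le_of_lineVal_ne_zero {D' : ℕ} (ξ : UIdx β γ δ D' → 𝓞 B.K) (s k : ℕ) {cg : Fin B.dd → ℕ}
    (hcg : ∀ m, cg m ≤ k) (hne : MvPolynomial.eval (fun m => (cg m : B.K)) (B.lineValPoly ξ s k) ≠ 0) :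
    1 ≤ ‖B.emb (MvPolynomial.eval (fun m => (cg m : B.K)) (B.lineValPoly ξ s k))‖ *
      |(B.dAt s : ℝ)| ^ B.expE (Fintype.card (β ⊕ (γ ⊕ δ)) * D') k *
        (|(B.dAt s : ℝ)| ^ B.expE (Fintype.card (β ⊕ (γ ⊕ δ)) * D') k * B.lineValBound ξ s k) ^ (B.gens.h - 1) := by
  set E := B.expE (Fintype.card (β ⊕ (γ ⊕ δ)) * D') k with hE
  set p := MvPolynomial.eval (fun m => (cg m : B.K)) (B.lineValPoly ξ s k) with hp
  set y : B.K := (B.dAt s : B.K) ^ E * p with hy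
  have hyint : IsIntegral ℤ y := B.intZ_lineVal ξ s k cg
  let x : 𝓞 B.K := ⟨y, hyint⟩
  have hx : x ≠ 0 := by
    intro h
    have : y = 0 := by simpa [x] using congrArg (fun z : 𝓞 B.K => (z : B.K)) h
    rw [hy] at this
    exact hne ((mul_eq_zero.mp this).resolve_left (pow_ne_zero _ (B.dAt_ne_zero s)))
  have hL := B.gens.one_le_norm_mul_house_pow hx
  -- `‖y‖ = |d_s|^E ‖emb p‖`, `house y ≤ |d_s|^E · bound`
  have hnormy : ‖((x : B.K) : ℂ)‖ = |(B.dAt s : ℝ)| ^ E * ‖B.emb p‖ := by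
    show ‖(y : ℂ)‖ = _
    have : (y : ℂ) = B.emb y := rfl
    rw [this, hy, map_mul, map_pow, norm_mul, norm_pow, map_intCast, Complex.norm_intCast]
  have hhouse : house (x : B.K) ≤ |(B.dAt s : ℝ)| ^ E * B.lineValBound ξ s k := by
    refine B.gens.house_le_of_forall_norm_le (by have := B.lineValBound_nonneg ξ s k; positivity) fun σ => ?_
    show ‖σ y‖ ≤ _
    rw [hy, map_mul, map_pow, norm_mul, norm_pow, map_intCast, Complex.norm_intCast]
    exact mul_le_mul_of_nonneg_left (B.norm_embedding_lineVal_le ξ s k hcg σ) (by positivity)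
  calc (1 : ℝ) ≤ ‖((x : B.K) : ℂ)‖ * house (x : B.K) ^ (B.gens.h - 1) := hL
    _ ≤ (|(B.dAt s : ℝ)| ^ E * ‖B.emb p‖) * (|(B.dAt s : ℝ)| ^ E * B.lineValBound ξ s k) ^ (B.gens.h - 1) := by
        rw [hnormy]
        exact mul_le_mul_of_nonneg_left (pow_le_pow_left₀ (house_nonneg _) hhouse _) (by positivity)
    _ = _ := by ring

/-- **Liouville, contrapositive form.** [cite: Baker1975, Ch. 2 Lemma 5] -/
theorem lineVal_eq_zero_of_norm_lt {D' : ℕ} (ξ : UIdx β γ δ D' → 𝓞 B.K) (s k : ℕ) {cg : Fin B.dd → ℕ}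
    (hcg : ∀ m, cg m ≤ k)
    (hlt : ‖B.emb (MvPolynomial.eval (fun m => (cg m : B.K)) (B.lineValPoly ξ s k))‖ *
      |(B.dAt s : ℝ)| ^ B.expE (Fintype.card (β ⊕ (γ ⊕ δ)) * D') k *
        (|(B.dAt s : ℝ)| ^ B.expE (Fintype.card (β ⊕ (γ ⊕ δ)) * D') k * B.lineValBound ξ s k) ^ (B.gens.h - 1) < 1) :
    MvPolynomial.eval (fun m => (cg m : B.K)) (B.lineValPoly ξ s k) = 0 := by
  by_contra hne
  exact absurd (B.one_le_of_lineVal_ne_zero ξ s k hcg hne) (not_le.mpr hlt)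


end BakerDataG

end Std

end GaGmE

end Literature.NumberTheory.Transcendental

end
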